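import Summits.KontsevichZagierPeriods.KontsevichZagierPeriods.Theses.SymplecticScissors
import Summits.KontsevichZagierPeriods.KontsevichZagierPeriods.Theorems.PlanarK0Injective.Negative.Kit
import Summits.KontsevichZagierPeriods.KontsevichZagierPeriods.Theorems.SymplecticScissorsPlanarAreasStubMixedPartials
import Summits.KontsevichZagierPeriods.KontsevichZagierPeriods.Theorems.SymplecticScissorsPlanarCompilerStubElementaryMovesAux
import Summits.KontsevichZagierPeriods.KontsevichZagierPeriods.Theorems.SymplecticScissorsPlanarCompilerStubBandAux

/-!
# `PlanarCompiler`, stub `stub_band` — the band identity for one cell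

Crux stmt-KontsevichZagierPeriods-10058 (`PlanarCompiler`, route SymplecticScissors), line
`twist-restoring-shear`, stub `stub_band`. Data: a cell compiler `Θ` (it sends a 1-dimensional
`[∫_σ f]` to `[cell of f⁺] − [cell of f⁻]`) mapping every instance of rules 1a / 1b / 2 into the
planar set-chain group `G`; a function `F`, `ℚ`-semialgebraic and continuous on the closed triangle,
`C¹` on a cell `C = {(x, y) | x ∈ (a, b), lo x < y < hi x}` of the open triangle, with `∂_y F` of
constant sign `ε ∈ {1, −1, 0}` on `C`; the integrand-`1` representation `r` on `Ψ_F(C)`,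
`Ψ_F (x, y) = (x, F (x, y))`, and the two trace representations `ρlo = [∫ F(t, lo t) dt]`,
`ρhi = [∫ F(t, hi t) dt]` over `(a, b)`. Claim: `ε • [r] − (Θ [ρhi] − Θ [ρlo]) ∈ G`.

Proof: by the mean value theorem `y ↦ F (x, y)` is strictly increasing / strictly decreasing /
constant on the closed fibre `[lo x, hi x]` (the closed fibre lies in the closed triangle, where `F`
is continuous; the open fibre lies in `C`, where the derivative has sign `ε`). Hence for `ε = ±1`
the image `Ψ_F(C)` is the open strip between the graphs of the two traces over `(a, b)` and the
claim is the strip lemma `band_strip_sub_mem_planarGroup` of the helper file (shear by the lower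
trace off a null vertical set, then rule 1b under `Θ`), up to the overall sign; for `ε = 0` the
two traces coincide, so `[ρhi] − [ρlo]` is an identity instance of rule 2, killed by `Θ`.
Small plane-geometry facts (`eq_vec`, `hasDerivAt_vecCons_snd`) are imported from the helper files
of stubs `stub_elementaryMoves` (this crux) and `stub_mixedPartials` (crux `PlanarAreas`).

[Kontsevich–Zagier 2001, §1.2] [folklore]
-/

noncomputable section

open MeasureTheory Set
open Literature.NumberTheory.Transcendental Literature.ModelTheory.ExponentialFields
open Summit.KontsevichZagierPeriods.KontsevichZagierPeriods.Theses.SymplecticScissors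
open Summit.KontsevichZagierPeriods.SymplecticScissors.PlanarK0InjectiveNegative

namespace Summit.KontsevichZagierPeriods.SymplecticScissors.PlanarCompilerProof

/-- **Stub 6 (M/L).** The band identity for ONE cell: if `y ↦ F(x, y)` is strictly increasing (`ε = 1`), strictly decreasing (`ε = −1`) or constant (`ε = 0`) on the fibres of the cell `C = {x ∈ (a,b), lo x < y < hi x}`, then `ε · [Ψ_F(C)] ≡ Θ[∫ F(t, hi t)] − Θ[∫ F(t, lo t)]` modulo `G` (`Ψ_F(C)` is the region between the two trace graphs; shear by the lower trace off finitely many verticals, then 1b under `Θ`). Stated for a general `F` so that it serves `A` and `B ∘ swap`. -/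
theorem stub_band :
    ∀ Θ : KZ.FormalRep →+ KZ.FormalRep, ((∀ ρ : KZ.IntegralRep 1, ∃ s t : KZ.IntegralRep 2, s.domain = {p : Fin 2 → ℝ | (fun _ : Fin 1 => p 0) ∈ ρ.domain ∧ 0 < p 1 ∧ p 1 < ρ.integrand (fun _ : Fin 1 => p 0)} ∧ t.domain = {p : Fin 2 → ℝ | (fun _ : Fin 1 => p 0) ∈ ρ.domain ∧ 0 < p 1 ∧ p 1 < -ρ.integrand (fun _ : Fin 1 => p 0)} ∧ (∀ p ∈ s.domain, s.integrand p = 1) ∧ (∀ p ∈ t.domain, t.integrand p = 1) ∧ Θ (KZ.of ρ) = KZ.of s - KZ.of t) ∧ (∀ (n : ℕ) (ρ : KZ.IntegralRep n), n ≠ 1 → Θ (KZ.of ρ) = 0)) → (∀ x ∈ KZ.domainAddRel ∪ KZ.integrandAddRel ∪ KZ.changeOfVariablesRel, Θ x ∈ AddSubgroup.closure ((KZ.domainAddRel ∪ KZ.changeOfVariablesRel) ∩ (AddSubgroup.closure {x : KZ.FormalRep | ∃ s : KZ.IntegralRep 2, (∀ p ∈ s.domain, s.integrand p = 1) ∧ x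 = KZ.of s} : Set KZ.FormalRep))) → ∀ (F : (Fin 2 → ℝ) → ℝ) (a b : ℝ) (lo hi : ℝ → ℝ) (ε : ℤ) (C : Set (Fin 2 → ℝ)), IsSemialgebraicFunOn ℚ {p : Fin 2 → ℝ | 0 ≤ p 0 ∧ 0 ≤ p 1 ∧ p 0 + p 1 ≤ 1} F → ContinuousOn F {p : Fin 2 → ℝ | 0 ≤ p 0 ∧ 0 ≤ p 1 ∧ p 0 + p 1 ≤ 1} → a < b → ContinuousOn lo (Set.Icc a b) → ContinuousOn hi (Set.Icc a b) → (∀ t ∈ Set.Ioo a b, lo t < hi t) → IsSemialgebraicFunOn ℚ {z : Fin 1 → ℝ | z 0 ∈ Set.Ioo a b} (fun z => lo (z 0)) → IsSemialgebraicFunOn ℚ {z : Fin 1 → ℝ | z 0 ∈ Set.Ioo a b} (fun z => hi (z 0)) → C = {p : Fin 2 → ℝ | p 0 ∈ Set.Ioo a b ∧ lo (p 0) < p 1 ∧ p 1 < hi (p 0)} → C ⊆ {p : Fin 2 → ℝ | 0 < p 0 ∧ 0 < p 1 ∧ p 0 + p 1 < 1} → IsSemialgebraic ℚ C → ContDiffOn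 ℝ 1 F C → (ε = 1 ∨ ε = -1 ∨ ε = 0) → (∀ p ∈ C, ε ≠ 0 → 0 < (ε : ℝ) * fderiv ℝ F p (Pi.single 1 1)) → (∀ p ∈ C, ε = 0 → fderiv ℝ F p (Pi.single 1 1) = 0) → ∀ (r : KZ.IntegralRep 2) (ρlo ρhi : KZ.IntegralRep 1), r.domain = (fun p : Fin 2 → ℝ => (![p 0, F p] : Fin 2 → ℝ)) '' C → (∀ q ∈ r.domain, r.integrand q = 1) → ρlo.domain = {z : Fin 1 → ℝ | z 0 ∈ Set.Ioo a b} → ρhi.domain = {z : Fin 1 → ℝ | z 0 ∈ Set.Ioo a b} → (∀ z ∈ ρlo.domain, ρlo.integrand z = F ![z 0, lo (z 0)]) → (∀ z ∈ ρhi.domain, ρhi.integrand z = F ![z 0, hi (z 0)]) → ε • KZ.of r - (Θ (KZ.of ρhi) - Θ (KZ.of ρlo)) ∈ AddSubgroup.closure ((KZ.domainAddRel ∪ KZ.changeOfVariablesRel) ∩ (AddSubgroup.closure {x : KZ.FormalRep | ∃ s : KZ.IntegralRep 2, (∀ p ∈ s.domain, s.integrand p = 1) ∧ x = KZ.of s}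 : Set KZ.FormalRep)) := by
  intro Θ hΘ hmoves F a b lo hi ε C _hF hFc _hab hloc hhic hlohi _hlo_sa _hhi_sa hC hCT _hCsa hFC1
    hε hpos hzero r ρlo ρhi hr hr1 hρlo hρhi hρlo_i hρhi_i
  show _ ∈ planarGroup
  have hmoves' : ∀ x ∈ KZ.domainAddRel ∪ KZ.integrandAddRel ∪ KZ.changeOfVariablesRel,
      Θ x ∈ planarGroup := hmoves
  have hdomeq : ρhi.domain = ρlo.domain := by rw [hρhi, hρlo]
  -- membership in the cell along a vertical fibre
  have hmemC : ∀ x ∈ Ioo a b, ∀ y ∈ Ioo (lo x) (hi x), (![x, y] : Fin 2 → ℝ) ∈ C := by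
    intro x hx y hy
    rw [hC]
    simpa using ⟨hx, hy.1, hy.2⟩
  -- the closed fibre lies in the closed triangle
  have hfib : ∀ x ∈ Ioo a b, 0 < x ∧ 0 ≤ lo x ∧ x + hi x ≤ 1 := by
    intro x hx
    have hT : ∀ y ∈ Ioo (lo x) (hi x), 0 < x ∧ 0 < y ∧ x + y < 1 := fun y hy => by
      simpa using hCT (hmemC x hx y hy)
    have hlh := hlohi x hx
    refine ⟨?_, ?_, ?_⟩
    · obtain ⟨y, hy⟩ := exists_between hlh
      exact (hT y hy).1
    · by_contra hneg
      push Not at hneg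
      obtain ⟨y, hy1, hy2⟩ := exists_between (lt_min hneg hlh)
      have h := hT y ⟨hy1, hy2.trans_le (min_le_right _ _)⟩
      linarith [hy2.trans_le (min_le_left _ _), h.2.1]
    · by_contra hneg
      push Not at hneg
      have hlt' : max (lo x) (1 - x) < hi x := max_lt hlh (by linarith)
      obtain ⟨y, hy1, hy2⟩ := exists_between hlt'
      have h := hT y ⟨(le_max_left _ _).trans_lt hy1, hy2⟩
      linarith [(le_max_right _ _).trans_lt hy1, h.2.2]
  have hmapsΔ : ∀ x ∈ Ioo a b, MapsTo (fun y : ℝ => (![x, y] : Fin 2 → ℝ)) (Icc (lo x) (hi x))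
      {p : Fin 2 → ℝ | 0 ≤ p 0 ∧ 0 ≤ p 1 ∧ p 0 + p 1 ≤ 1} := by
    intro x hx y hy
    obtain ⟨h0, h1, h2⟩ := hfib x hx
    simp only [mem_setOf_eq, Matrix.cons_val_zero, Matrix.cons_val_one]
    exact ⟨h0.le, h1.trans hy.1, by linarith [hy.2]⟩
  -- the vertical line `y ↦ (x, y)`: velocity `e₁`, continuity
  have hγ : ∀ x y : ℝ, HasDerivAt (fun y : ℝ => (![x, y] : Fin 2 → ℝ)) (Pi.single 1 1) y :=
    fun x y => by simpa using PlanarAreas.hasDerivAt_vecCons_snd ![x, 0] y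
  have hγc : ∀ x : ℝ, Continuous (fun y : ℝ => (![x, y] : Fin 2 → ℝ)) := fun x =>
    continuous_iff_continuousAt.2 fun y => (hγ x y).continuousAt
  -- continuity of `F` on the closed fibre
  have hcont : ∀ x ∈ Ioo a b, ContinuousOn (fun y : ℝ => F ![x, y]) (Icc (lo x) (hi x)) :=
    fun x hx => hFc.comp (hγc x).continuousOn (hmapsΔ x hx)
  -- the cell is open
  have hCo : IsOpen C := by
    rw [hC, isOpen_iff_mem_nhds]
    rintro p ⟨hp0, hp1, hp2⟩
    have hIcc : Icc a b ∈ nhds (p 0) := Icc_mem_nhds hp0.1 hp0.2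
    have h0 : ContinuousAt (fun q : Fin 2 → ℝ => q 0) p := (continuous_apply 0).continuousAt
    have h1 : ContinuousAt (fun q : Fin 2 → ℝ => q 1) p := (continuous_apply 1).continuousAt
    have hloA : ContinuousAt (fun q : Fin 2 → ℝ => lo (q 0)) p :=
      ContinuousAt.comp (hloc.continuousAt hIcc) h0
    have hhiA : ContinuousAt (fun q : Fin 2 → ℝ => hi (q 0)) p :=
      ContinuousAt.comp (hhic.continuousAt hIcc) h0
    have e0 : ∀ᶠ q in nhds p, q 0 ∈ Ioo a b := h0.eventually_mem (Ioo_mem_nhds hp0.1 hp0.2)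
    have e1 : ∀ᶠ q in nhds p, lo (q 0) < q 1 := hloA.eventually_lt h1 hp1
    have e2 : ∀ᶠ q in nhds p, q 1 < hi (q 0) := h1.eventually_lt hhiA hp2
    filter_upwards [e0, e1, e2] with q hq0 hq1 hq2
    exact ⟨hq0, hq1, hq2⟩
  -- the derivative of `F` along a vertical fibre
  have hderiv : ∀ x ∈ Ioo a b, ∀ y ∈ Ioo (lo x) (hi x),
      HasDerivAt (fun y : ℝ => F ![x, y]) (fderiv ℝ F ![x, y] (Pi.single 1 1)) y := by
    intro x hx y hy
    have hd : DifferentiableAt ℝ F ![x, y] :=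
      (hFC1.differentiableOn one_ne_zero _ (hmemC x hx y hy)).differentiableAt
        (hCo.mem_nhds (hmemC x hx y hy))
    exact hd.hasFDerivAt.comp_hasDerivAt y (hγ x y)
  rcases hε with hε1 | hε1 | hε0
  · -- increasing fibres
    subst hε1
    have hmono : ∀ x ∈ Ioo a b, StrictMonoOn (fun y : ℝ => F ![x, y]) (Icc (lo x) (hi x)) := by
      intro x hx
      refine strictMonoOn_of_deriv_pos (convex_Icc _ _) (hcont x hx) fun y hy => ?_
      rw [interior_Icc] at hy
      rw [(hderiv x hx y hy).deriv]
      have h := hpos _ (hmemC x hx y hy) one_ne_zero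
      simpa using h
    have hlt : ∀ z ∈ ρlo.domain, ρlo.integrand z < ρhi.integrand z := by
      intro z hz
      have hz' : z ∈ ρhi.domain := hdomeq ▸ hz
      have hx : z 0 ∈ Ioo a b := by rw [hρlo] at hz; exact hz
      rw [hρlo_i z hz, hρhi_i z hz']
      have hlh := hlohi _ hx
      exact hmono _ hx (left_mem_Icc.2 hlh.le) (right_mem_Icc.2 hlh.le) hlh
    have hdomr : r.domain = {p : Fin 2 → ℝ | (fun _ : Fin 1 => p 0) ∈ ρlo.domain ∧
        ρlo.integrand (fun _ : Fin 1 => p 0) < p 1 ∧ p 1 < ρhi.integrand (fun _ : Fin 1 => p 0)} := by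
      rw [hr]
      ext q
      constructor
      · rintro ⟨p, hpC, rfl⟩
        have hpC' : p 0 ∈ Ioo a b ∧ lo (p 0) < p 1 ∧ p 1 < hi (p 0) := by rw [hC] at hpC; exact hpC
        obtain ⟨hx, hy1, hy2⟩ := hpC'
        have hz : (fun _ : Fin 1 => p 0) ∈ ρlo.domain := by rw [hρlo]; exact hx
        have hz' : (fun _ : Fin 1 => p 0) ∈ ρhi.domain := hdomeq ▸ hz
        simp only [mem_setOf_eq, Matrix.cons_val_zero, Matrix.cons_val_one]
        refine ⟨hz, ?_, ?_⟩
        · rw [hρlo_i _ hz]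
          have h := hmono _ hx (left_mem_Icc.2 (hlohi _ hx).le) ⟨hy1.le, hy2.le⟩ hy1
          simpa only [← ElementaryMoves.eq_vec] using h
        · rw [hρhi_i _ hz']
          have h := hmono _ hx ⟨hy1.le, hy2.le⟩ (right_mem_Icc.2 (hlohi _ hx).le) hy2
          simpa only [← ElementaryMoves.eq_vec] using h
      · rintro ⟨hz, h1, h2⟩
        have hx : q 0 ∈ Ioo a b := by rw [hρlo] at hz; exact hz
        have hz' : (fun _ : Fin 1 => q 0) ∈ ρhi.domain := hdomeq ▸ hz
        rw [hρlo_i _ hz] at h1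
        rw [hρhi_i _ hz'] at h2
        obtain ⟨y, hy, hyq⟩ := intermediate_value_Ioo (hlohi _ hx).le (hcont _ hx) ⟨h1, h2⟩
        refine ⟨![q 0, y], hmemC _ hx y hy, ?_⟩
        have hyq' : F ![q 0, y] = q 1 := hyq
        ext i
        fin_cases i
        · simp
        · simp [hyq']
    have key := band_strip_sub_mem_planarGroup Θ hΘ hmoves' ρlo ρhi r hdomeq hlt hdomr hr1
    simpa only [one_smul] using key
  · -- decreasing fibres
    subst hε1
    have hanti : ∀ x ∈ Ioo a b, StrictAntiOn (fun y : ℝ => F ![x, y]) (Icc (lo x) (hi x)) := by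
      intro x hx
      refine strictAntiOn_of_deriv_neg (convex_Icc _ _) (hcont x hx) fun y hy => ?_
      rw [interior_Icc] at hy
      rw [(hderiv x hx y hy).deriv]
      have h := hpos _ (hmemC x hx y hy) (by norm_num)
      simp only [Int.cast_neg, Int.cast_one, neg_mul, one_mul, Left.neg_pos_iff] at h
      exact h
    have hlt : ∀ z ∈ ρhi.domain, ρhi.integrand z < ρlo.integrand z := by
      intro z hz'
      have hz : z ∈ ρlo.domain := hdomeq.symm ▸ hz'
      have hx : z 0 ∈ Ioo a b := by rw [hρlo] at hz; exact hz
      rw [hρlo_i z hz, hρhi_i z hz']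
      have hlh := hlohi _ hx
      exact hanti _ hx (left_mem_Icc.2 hlh.le) (right_mem_Icc.2 hlh.le) hlh
    have hdomr : r.domain = {p : Fin 2 → ℝ | (fun _ : Fin 1 => p 0) ∈ ρhi.domain ∧
        ρhi.integrand (fun _ : Fin 1 => p 0) < p 1 ∧ p 1 < ρlo.integrand (fun _ : Fin 1 => p 0)} := by
      rw [hr]
      ext q
      constructor
      · rintro ⟨p, hpC, rfl⟩
        have hpC' : p 0 ∈ Ioo a b ∧ lo (p 0) < p 1 ∧ p 1 < hi (p 0) := by rw [hC] at hpC; exact hpC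
        obtain ⟨hx, hy1, hy2⟩ := hpC'
        have hz : (fun _ : Fin 1 => p 0) ∈ ρlo.domain := by rw [hρlo]; exact hx
        have hz' : (fun _ : Fin 1 => p 0) ∈ ρhi.domain := hdomeq ▸ hz
        simp only [mem_setOf_eq, Matrix.cons_val_zero, Matrix.cons_val_one]
        refine ⟨hz', ?_, ?_⟩
        · rw [hρhi_i _ hz']
          have h := hanti _ hx ⟨hy1.le, hy2.le⟩ (right_mem_Icc.2 (hlohi _ hx).le) hy2
          simpa only [← ElementaryMoves.eq_vec] using h
        · rw [hρlo_i _ hz]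
          have h := hanti _ hx (left_mem_Icc.2 (hlohi _ hx).le) ⟨hy1.le, hy2.le⟩ hy1
          simpa only [← ElementaryMoves.eq_vec] using h
      · rintro ⟨hz', h1, h2⟩
        have hz : (fun _ : Fin 1 => q 0) ∈ ρlo.domain := hdomeq.symm ▸ hz'
        have hx : q 0 ∈ Ioo a b := by rw [hρlo] at hz; exact hz
        rw [hρhi_i _ hz'] at h1
        rw [hρlo_i _ hz] at h2
        obtain ⟨y, hy, hyq⟩ := intermediate_value_Ioo' (hlohi _ hx).le (hcont _ hx) ⟨h1, h2⟩
        refine ⟨![q 0, y], hmemC _ hx y hy, ?_⟩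
        have hyq' : F ![q 0, y] = q 1 := hyq
        ext i
        fin_cases i
        · simp
        · simp [hyq']
    have key := band_strip_sub_mem_planarGroup Θ hΘ hmoves' ρhi ρlo r hdomeq.symm hlt hdomr hr1
    have key' := planarGroup.neg_mem key
    convert key' using 1
    simp only [neg_one_smul]
    abel
  · -- flat fibres: the two traces coincide
    subst hε0
    have hconst : ∀ x ∈ Ioo a b, F ![x, hi x] = F ![x, lo x] := by
      intro x hx
      have hlh := hlohi x hx
      obtain ⟨c, hc, hc'⟩ := exists_hasDerivAt_eq_slope (fun y : ℝ => F ![x, y])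
        (fun y => fderiv ℝ F ![x, y] (Pi.single 1 1)) hlh (hcont x hx) (hderiv x hx)
      rw [hzero _ (hmemC x hx c hc) rfl, eq_comm, div_eq_zero_iff, sub_eq_zero] at hc'
      rcases hc' with h | h
      · exact h
      · exact absurd (sub_eq_zero.1 h) hlh.ne'
    have hint : ∀ z ∈ ρhi.domain, ρhi.integrand z = ρlo.integrand z := by
      intro z hz'
      have hz : z ∈ ρlo.domain := hdomeq ▸ hz'
      have hx : z 0 ∈ Ioo a b := by rw [hρlo] at hz; exact hz
      rw [hρlo_i z hz, hρhi_i z hz', hconst _ hx]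
    have hcov : KZ.of ρhi - KZ.of ρlo ∈ KZ.changeOfVariablesRel := by
      refine ⟨1, ρhi, ρlo, id, fun _ => ContinuousLinearMap.id ℝ (Fin 1 → ℝ),
        isSemialgebraicMapOn_id ρhi.isSemialgebraic_domain,
        fun x _ => (ContinuousLinearMap.id ℝ (Fin 1 → ℝ)).hasFDerivWithinAt, injOn_id _,
        by rw [image_id, hdomeq], fun x hx => ?_, rfl⟩
      have hdet : (ContinuousLinearMap.id ℝ (Fin 1 → ℝ)).det = 1 := by
        show LinearMap.det ((ContinuousLinearMap.id ℝ (Fin 1 → ℝ) :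
          (Fin 1 → ℝ) →ₗ[ℝ] (Fin 1 → ℝ))) = 1
        rw [ContinuousLinearMap.coe_id, LinearMap.det_id]
      rw [hint x hx, hdet]
      simp
    have key := hmoves' _ (Or.inr hcov)
    rw [map_sub] at key
    have key' := planarGroup.neg_mem key
    convert key' using 1
    simp only [zero_smul]
    abel

end Summit.KontsevichZagierPeriods.SymplecticScissors.PlanarCompilerProof
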